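import Literature.MathematicalPhysics.QuantumLattice.HubbardChemicalPotentialTL
import Summits.Ventures.CertifiedManyBodySolver.Certificates.HubbardSquare_n1_lower_row220
import Summits.Ventures.CertifiedManyBodySolver.Certificates.HubbardSquare_n7o8_upper_row166
import HarnessLib

/-!
# Ventures/CertifiedManyBodySolver — Certificates/HubbardSquare_U8_chemPot_gapcard.lean

HONEST FRAMING: first certified bounds; not a superconductivity verdict; every number certified or labelled float.

DERIVED thermodynamic-limit row (LEAD D-19 r126 (c)(4): "derived: secant of CERTIFIED #220/#166 + convexity + particle–hole,
tree theorems by name"; NOT a CERTIFIED.md row; adv-2 GAP-CARD v0.1, `speedrun/mbsolver/m2/GAP-CARD.md`): the chemical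
potentials and the charge gap of the square-lattice Hubbard model at `t = 1`, `t′ = 0`, `U = 8`, half filling, as statements about
the NAMED thermodynamic-limit objects of `Literature/MathematicalPhysics/QuantumLattice/HubbardChemicalPotentialTL.lean`
(`chemPotMinusTT'` = μ₋ = left derivative of the convex `energyDensityTT'` in the density, `chemPotPlusTT'` = μ₊ = right
derivative, `chargeGapTT'` = μ₊ − μ₋; Lieb–Wu 2003 §7, Lieb–Wu 1968 eq. (21)–(22)). Inputs: ONE M2 energy FLOOR at `n = 1`
(`M2EnergyLowerRow 8 lo`) and ONE M3 (`t′ = 0`) energy CEILING at `n = 7/8` (`M3EnergyUpperRow 0 hi`) — generic in `(lo, hi)`,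
then the literal cell rows #220 / #166 BY NAME (their claim nodes enter as hypotheses; nothing is asserted unconditionally; no
certificate is read here). Shape of the bounds: `μ₋(1) ≥ 8(lo − hi)` (secant over `[7/8, 1]` ≤ left derivative at `1`),
`μ₊(1) = U − μ₋(1) ≤ 8 − 8(lo − hi)`, `Δ_c(1) = U − 2μ₋(1) ≤ 8 − 16(lo − hi)`; and `μ₊(7/8) ≤ 8(hi′ − lo′)` from an M3 floor at
`7/8` and an M2 ceiling at `1` (also at `t′ = −1/4`, using `e(t,t′,U,1) ≤ energyDensity2D t U 1`). Literal values on (#220, #166):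
`μ₋(U=8, n=1) ≥ 106805091802914750755687/2⁷⁷ ≈ 0.7067768`, `Δ_c(U=8, n=1) ≤ 497657818004399836597401/2⁷⁶ ≈ 6.5864464`.
HONEST LABELS: sign and margin only (μ₋ > 0.70; Δ_c < U by 1.41); no printed 2D `U = 8` thermodynamic-limit comparator exists
(Vitali–Shi–Qin–Zhang 2016 print Δ_c/2 up to U ≈ 6 only); NO floor on `Δ_c` follows from energies + convexity + particle–hole
(`chargeGapTT'_nonneg` is the whole lower side). Theorems only; no definitions, no new claim node, no `sorry`.
Prepared by pub-mbboot-lit g31 (staged `speedrun/mbsolver/pub-mbboot-lit/g31/`); filed at the discretion of m2-4 / typer per r126.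
-/

noncomputable section

namespace Summit.Ventures.CertifiedManyBodySolver.Certificates

open Literature.MathematicalPhysics.QuantumLattice
open Literature.MathematicalPhysics.QuantumLattice.ThermodynamicLimit

/-- μ₋(U = 8, n = 1) FLOOR from an M2 energy floor at n = 1 and an M3 (t′ = 0) energy ceiling at n = 7/8:
`8 (lo − hi) ≤ μ₋(1)` (secant over [7/8, 1] ≤ left derivative at 1). -/
theorem chemPotMinus_U8_n1_ge_of_rows {lo hi : ℚ} (hlo : M2EnergyLowerRow 8 lo) (hhi : M3EnergyUpperRow 0 hi) :
    (((8 * (lo - hi) : ℚ)) : ℝ) ≤ chemPotMinusTT' 1 0 8 1 := by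
  have hhi' : energyDensity2D 1 8 (7 / 8) ≤ ((hi : ℚ) : ℝ) := by
    have h : energyDensityTT' 1 0 8 (7 / 8) ≤ ((hi : ℚ) : ℝ) := hhi
    rwa [energyDensityTT'_zero] at h
  have h := chemPotMinusTT'_zero_one_ge_of_bounds 1 (by norm_num : (0 : ℝ) ≤ 8) (by norm_num) (by norm_num) hlo hhi'
  have e : (((8 * (lo - hi) : ℚ)) : ℝ) = (((lo : ℚ) : ℝ) - ((hi : ℚ) : ℝ)) / (1 - 7 / 8) := by
    push_cast; ring
  rw [e]; exact h

/-- μ₊(U = 8, n = 1) CEILING by particle–hole symmetry (`μ₊(1) + μ₋(1) = U`): `μ₊(1) ≤ 8 − 8 (lo − hi)`. -/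
theorem chemPotPlus_U8_n1_le_of_rows {lo hi : ℚ} (hlo : M2EnergyLowerRow 8 lo) (hhi : M3EnergyUpperRow 0 hi) :
    chemPotPlusTT' 1 0 8 1 ≤ (((8 - 8 * (lo - hi) : ℚ)) : ℝ) := by
  have h1 := chemPotMinus_U8_n1_ge_of_rows hlo hhi
  have h2 := chemPotPlusTT'_add_chemPotMinusTT'_one 1 (by norm_num : (0 : ℝ) ≤ 8)
  push_cast at h1 ⊢
  linarith

/-- Charge-gap CEILING at U = 8, half filling: `Δ_c(1) = U − 2 μ₋(1) ≤ 8 − 16 (lo − hi)`. No floor is claimed. -/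
theorem chargeGap_U8_n1_le_of_rows {lo hi : ℚ} (hlo : M2EnergyLowerRow 8 lo) (hhi : M3EnergyUpperRow 0 hi) :
    chargeGapTT' 1 0 8 1 ≤ (((8 - 16 * (lo - hi) : ℚ)) : ℝ) := by
  have h1 := chemPotMinus_U8_n1_ge_of_rows hlo hhi
  rw [chargeGapTT'_one_eq_sub_two_mul 1 (by norm_num : (0 : ℝ) ≤ 8)]
  push_cast at h1 ⊢
  linarith

/-- μ₊(U = 8, n = 7/8) CEILING (right derivative ≤ secant over [7/8, 1]) from an M3 (t′ = 0) energy FLOOR at n = 7/8 and an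
M2 energy CEILING at n = 1: `μ₊(7/8) ≤ 8 (hi − lo)`. -/
theorem chemPotPlus_U8_n7o8_le_of_rows {lo hi : ℚ} (hlo : M3EnergyLowerRow 0 lo) (hhi : M2EnergyUpperRow 8 hi) :
    chemPotPlusTT' 1 0 8 (7 / 8) ≤ (((8 * (hi - lo) : ℚ)) : ℝ) := by
  have hlo' : ((lo : ℚ) : ℝ) ≤ energyDensityTT' 1 0 8 (7 / 8) := hlo
  have hhi' : energyDensityTT' 1 0 8 1 ≤ ((hi : ℚ) : ℝ) := by
    have h : energyDensity2D 1 8 1 ≤ ((hi : ℚ) : ℝ) := hhi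
    rwa [← energyDensityTT'_zero] at h
  have h := chemPotPlusTT'_le_of_bounds 1 0 (by norm_num : (0 : ℝ) ≤ 8) (by norm_num) (by norm_num) one_lt_two hlo' hhi'
  have e : (((8 * (hi - lo) : ℚ)) : ℝ) = (((hi : ℚ) : ℝ) - ((lo : ℚ) : ℝ)) / (1 - 7 / 8) := by
    push_cast; ring
  rw [e]; exact h

/-- μ₊(U = 8, t′ = −1/4, n = 7/8) CEILING from an M3 t′ = −1/4 energy FLOOR at n = 7/8 and an M2 (t′ = 0) half-filling CEILING
(`e(1,−1/4,8,1) ≤ energyDensity2D 1 8 1`, concave + even in t′): `μ₊ ≤ 8 (hi − lo)`. -/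
theorem chemPotPlus_U8_tpm1o4_n7o8_le_of_rows {lo hi : ℚ} (hlo : M3EnergyLowerRow (-1/4) lo) (hhi : M2EnergyUpperRow 8 hi) :
    chemPotPlusTT' 1 (-1/4) 8 (7 / 8) ≤ (((8 * (hi - lo) : ℚ)) : ℝ) := by
  have hlo' : ((lo : ℚ) : ℝ) ≤ energyDensityTT' 1 (-1/4) 8 (7 / 8) := hlo
  have hhi' : energyDensity2D 1 8 1 ≤ ((hi : ℚ) : ℝ) := hhi
  have h := chemPotPlusTT'_le_of_bounds_halfFilling2D 1 (-1/4) (by norm_num : (0 : ℝ) ≤ 8) (by norm_num) (by norm_num) hlo' hhi'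
  have e : (((8 * (hi - lo) : ℚ)) : ℝ) = (((hi : ℚ) : ℝ) - ((lo : ℚ) : ℝ)) / (1 - 7 / 8) := by
    push_cast; ring
  rw [e]; exact h

/-- GAP-CARD v0.1 literal: CERTIFIED #220 (M2 U=8 floor) and #166 (M3 t′=0 ceiling) BY NAME ⇒
`μ₋(U = 8, n = 1) ≥ 106805091802914750755687/2⁷⁷ ≈ 0.7067768`. -/
theorem chemPotMinus_U8_n1_ge_r220_r166 (h220 : cert_r220_hubSQ_hanK6_U8_r4_e0_M)
    (h166 : cert_r166_openbox_32x4_U8_N112_tp0_D1000_b2) :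
    ((106805091802914750755687 / 2 ^ 77 : ℚ) : ℝ) ≤ chemPotMinusTT' 1 0 8 1 := by
  have h := chemPotMinus_U8_n1_ge_of_rows (m2_U8_lower_r220_of h220) (m3_tp0_upper_r166_of h166)
  refine le_trans (le_of_eq ?_) h
  norm_num

/-- GAP-CARD v0.1 literal: `Δ_c(U = 8, n = 1) ≤ 497657818004399836597401/2⁷⁶ ≈ 6.5864464` from #220 / #166 BY NAME. -/
theorem chargeGap_U8_n1_le_r220_r166 (h220 : cert_r220_hubSQ_hanK6_U8_r4_e0_M)
    (h166 : cert_r166_openbox_32x4_U8_N112_tp0_D1000_b2) :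
    chargeGapTT' 1 0 8 1 ≤ ((497657818004399836597401 / 2 ^ 76 : ℚ) : ℝ) := by
  have h := chargeGap_U8_n1_le_of_rows (m2_U8_lower_r220_of h220) (m3_tp0_upper_r166_of h166)
  refine h.trans (le_of_eq ?_)
  norm_num

end Summit.Ventures.CertifiedManyBodySolver.Certificates

end
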